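import Summits.CriticalPhenomena.PercolationContinuityZ3.Theorems.PercNearOneGluingNoHeavyLowerTailThreePointProductFormOneStepBoundary
import Mathlib.Algebra.BigOperators.Fin
import Mathlib.Tactic.FieldSimp
import HarnessLib

/-!
# The ONE-STEP LEMMA of the product form (P) — II: general children by mixture (Sahi programme, prover prim-sahi-p2 gen 59)

Support file (`--supports stmt-CriticalPhenomena-4575`, helper); companion of `…ThreePointProductFormOneStepBoundary` (same gen).
Standard axioms, no sorries, no named facts, no definitions.  Memo `run/shared/lean/prim/prim-sahi/FROM-prim-sahi-p2-gen59-ONE-STEP-LEMMA.md`,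
`prim-sahi-p2/PROOF-E3.md` §69.

THE ONE-STEP LEMMA (gen 58 memo §2b / PROOF-E3 (68j), proved here).  For a finite family of children `i` with real weights
`a_i ≥ 0, b_i ≥ 0, d_i ≤ n_i, d_i² ≤ a_i b_i` (in the application: `(a, b, d, n)_u = (#P1_u, #P2_u, #bad_u, 2#S0_u − #bad_u)` of the
sub-instance at a child `u` of a vertex of a tree-like fibre), with `σ = a + b + d + n`:
* **`oneStep_productForm`** — `(∏ σ − ∏ (b+n) − ∏ (a+n) + ∏ n)² ≤ (∏ (σ+a) − ∏ σ) · (∏ (σ+b) − ∏ σ)`   (vertex joined to neither `s` nor `c`);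
* **`oneStep_productForm_marked`** — `(∏ σ − ∏ (a+n))² ≤ ∏ (σ+a) · (∏ (σ+b) − ∏ σ)`   (vertex joined to `s`);
* **`oneStep_productForm_marked'`** — `(∏ σ − ∏ (b+n))² ≤ (∏ (σ+a) − ∏ σ) · ∏ (σ+b)`   (vertex joined to `c`).
PROOF.  Every admissible child is an explicit nonnegative combination of at most two BOUNDARY children `(u², w², uw, uw)` and a NULL
child `(0,0,0,1)`:  `(a, b, d, n) = a⁻¹·(a², d², ad, ad) + (b − d²/a)·(0, 1, 0, 0) + (n − d)·(0, 0, 0, 1)` (`sum_three_mix`; Lean's `0⁻¹ = 0`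
makes the formula uniform, using `a = 0 → d = 0`).  The six quantities `∏ σ, ∏ (b+n), ∏ (a+n), ∏ n, ∏ (σ+a), ∏ (σ+b)` are products of
LINEAR forms of the children, so they expand (`Fintype.prod_sum`) as `Σ_L w_L · (pure value)` over the assignments `L : ι → Fin 3` of a
component to every child, with `w_L = ∏_i (weight of component L i) ≥ 0` (`expand_form`).  For a pure assignment the null children
contribute the factor `1` and the others form a boundary system, where part I gives `f_L² ≤ A_L B_L` (`pure_productForm`); the
Cauchy–Schwarz inequality `Finset.sum_sq_le_sum_mul_sum_of_sq_le_mul` then gives `(Σ w_L f_L)² ≤ (Σ w_L A_L)(Σ w_L B_L)`.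
[this work] (gen 59); [folklore] (Cauchy–Schwarz; multilinear expansion).
-/

namespace Summit.CriticalPhenomena.PercolationContinuityZ3.Theorems.ProductFormOneStep

open Finset

/-! ### 1. One child: the three-component mixture -/

/-- **Mixture identity for one child.**  For a linear form `ca·a + cb·b + cd·d + cn·n` with `cn = 1` whose boundary value `F(u, w)`
satisfies `F(a, d) = ca·a² + cb·d² + (cd + cn)·ad` and `F(0,1) = cb`:
`a⁻¹·F(a,d) + (b − d²/a)·F(0,1) + (n − d)·1 = ca·a + cb·b + cd·d + cn·n` (given `a = 0 → d = 0`; `0⁻¹ = 0`), written as a sum over the three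
components `k = 0` (boundary child `(u,w) = (a,d)`, weight `a⁻¹`), `k = 1` (boundary child `(0,1)`, weight `b − d²/a`), `k = 2` (null, weight `n − d`). [this work] -/
theorem sum_three_mix (a b d n ca cb cd cn : ℝ) (F : ℝ → ℝ → ℝ)
    (hF0 : F a d = ca * a ^ 2 + cb * d ^ 2 + (cd + cn) * (a * d)) (hF1 : F 0 1 = cb) (hcn : cn = 1)
    (h0 : a = 0 → d = 0) :
    ∑ k : Fin 3, (if k = 0 then a⁻¹ else if k = 1 then b - d ^ 2 / a else n - d) *
        (if k ≠ 2 then F (if k = 0 then a else 0) (if k = 0 then d else 1) else 1) =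
      ca * a + cb * b + cd * d + cn * n := by
  rw [Fin.sum_univ_three]
  simp only [Fin.isValue, ↓reduceIte, ne_eq, Fin.reduceEq, not_false_eq_true, not_true_eq_false, mul_one]
  rw [hF0, hF1, hcn]
  rcases eq_or_ne a 0 with h | h
  · have hd := h0 h
    subst h; subst hd
    ring
  · field_simp
    ring

/-- The three weights of the mixture are nonnegative when `a ≥ 0`, `b ≥ 0`, `d ≤ n`, `d² ≤ ab`. [this work] -/
theorem mix_weight_nonneg (a b d n : ℝ) (ha : 0 ≤ a) (hb : 0 ≤ b) (hdn : d ≤ n) (hP : d ^ 2 ≤ a * b) (k : Fin 3) :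
    0 ≤ (if k = 0 then a⁻¹ else if k = 1 then b - d ^ 2 / a else n - d) := by
  split_ifs with h1 h2
  · exact inv_nonneg.mpr ha
  · rcases eq_or_lt_of_le ha with h | h
    · rw [← h]; simp [hb]
    · rw [sub_nonneg, div_le_iff₀ h]; linarith [mul_comm a b]
  · linarith

/-- `d² ≤ a·b` with `a = 0` forces `d = 0`. [folklore] -/
theorem d_eq_zero_of_a_eq_zero {a b d : ℝ} (hP : d ^ 2 ≤ a * b) (h : a = 0) : d = 0 := by
  subst h
  have : d ^ 2 ≤ 0 := by simpa using hP
  exact pow_eq_zero_iff (n := 2) (by norm_num) |>.mp (le_antisymm this (sq_nonneg d))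

/-! ### 2. The multilinear expansion over pure assignments -/

section Expansion

variable {ι : Type*} [Fintype ι] [DecidableEq ι]

/-- **Expansion of a product of linear forms over the pure assignments `L : ι → Fin 3`.** [this work] -/
theorem expand_form (a b d n : ι → ℝ) (ca cb cd cn : ℝ) (F : ℝ → ℝ → ℝ)
    (hF0 : ∀ i, F (a i) (d i) = ca * a i ^ 2 + cb * d i ^ 2 + (cd + cn) * (a i * d i)) (hF1 : F 0 1 = cb) (hcn : cn = 1)
    (h0 : ∀ i, a i = 0 → d i = 0) :
    ∏ i, (ca * a i + cb * b i + cd * d i + cn * n i) =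
      ∑ L : ι → Fin 3, (∏ i, (if L i = 0 then (a i)⁻¹ else if L i = 1 then b i - d i ^ 2 / a i else n i - d i)) *
        ∏ i, (if L i ≠ 2 then F (if L i = 0 then a i else 0) (if L i = 0 then d i else 1) else 1) := by
  have h : ∀ i, ca * a i + cb * b i + cd * d i + cn * n i =
      ∑ k : Fin 3, (if k = 0 then (a i)⁻¹ else if k = 1 then b i - d i ^ 2 / a i else n i - d i) *
        (if k ≠ 2 then F (if k = 0 then a i else 0) (if k = 0 then d i else 1) else 1) :=
    fun i => (sum_three_mix (a i) (b i) (d i) (n i) ca cb cd cn F (hF0 i) hF1 hcn (h0 i)).symm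
  simp_rw [h]
  rw [Fintype.prod_sum]
  refine Finset.sum_congr rfl fun L _ => ?_
  rw [← Finset.prod_mul_distrib]

omit [DecidableEq ι] in
/-- The weight of a pure assignment is nonnegative. [this work] -/
theorem weight_nonneg (a b d n : ι → ℝ) (ha : ∀ i, 0 ≤ a i) (hb : ∀ i, 0 ≤ b i) (hdn : ∀ i, d i ≤ n i)
    (hP : ∀ i, d i ^ 2 ≤ a i * b i) (L : ι → Fin 3) :
    0 ≤ ∏ i, (if L i = 0 then (a i)⁻¹ else if L i = 1 then b i - d i ^ 2 / a i else n i - d i) :=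
  Finset.prod_nonneg fun i _ => mix_weight_nonneg (a i) (b i) (d i) (n i) (ha i) (hb i) (hdn i) (hP i) (L i)

omit [DecidableEq ι] in
/-- A pure product is the boundary product over the non-null children. [this work] -/
theorem pure_prod_eq (a d : ι → ℝ) (L : ι → Fin 3) (F : ℝ → ℝ → ℝ) :
    ∏ i, (if L i ≠ 2 then F (if L i = 0 then a i else 0) (if L i = 0 then d i else 1) else 1) =
      ∏ i ∈ univ.filter (fun i => L i ≠ 2), F (if L i = 0 then a i else 0) (if L i = 0 then d i else 1) := by
  rw [Finset.prod_filter]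

/-- **(P) for a pure assignment**: the non-null children form a boundary system (part I, `boundary_productForm`). [this work] -/
theorem pure_productForm (a d : ι → ℝ) (L : ι → Fin 3) :
    ((∏ i, (if L i ≠ 2 then ((if L i = 0 then a i else 0) + (if L i = 0 then d i else 1)) ^ 2 else 1)) -
      (∏ i, (if L i ≠ 2 then (if L i = 0 then d i else 1) * ((if L i = 0 then a i else 0) + (if L i = 0 then d i else 1)) else 1)) -
      (∏ i, (if L i ≠ 2 then (if L i = 0 then a i else 0) * ((if L i = 0 then a i else 0) + (if L i = 0 then d i else 1)) else 1)) +
      ∏ i, (if L i ≠ 2 then (if L i = 0 then a i else 0) * (if L i = 0 then d i else 1) else 1)) ^ 2 ≤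
    ((∏ i, (if L i ≠ 2 then ((if L i = 0 then a i else 0) + (if L i = 0 then d i else 1)) ^ 2 + (if L i = 0 then a i else 0) ^ 2 else 1)) -
      ∏ i, (if L i ≠ 2 then ((if L i = 0 then a i else 0) + (if L i = 0 then d i else 1)) ^ 2 else 1)) *
    ((∏ i, (if L i ≠ 2 then ((if L i = 0 then a i else 0) + (if L i = 0 then d i else 1)) ^ 2 + (if L i = 0 then d i else 1) ^ 2 else 1)) -
      ∏ i, (if L i ≠ 2 then ((if L i = 0 then a i else 0) + (if L i = 0 then d i else 1)) ^ 2 else 1)) := by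
  rw [pure_prod_eq a d L (fun u w => (u + w) ^ 2), pure_prod_eq a d L (fun u w => w * (u + w)),
    pure_prod_eq a d L (fun u w => u * (u + w)), pure_prod_eq a d L (fun u w => u * w),
    pure_prod_eq a d L (fun u w => (u + w) ^ 2 + u ^ 2), pure_prod_eq a d L (fun u w => (u + w) ^ 2 + w ^ 2)]
  exact boundary_productForm _ _ _

/-- (P) for a pure assignment, vertex joined to `s` (part I, `boundary_productForm_marked`). [this work] -/
theorem pure_productForm_marked (a d : ι → ℝ) (L : ι → Fin 3) :
    ((∏ i, (if L i ≠ 2 then ((if L i = 0 then a i else 0) + (if L i = 0 then d i else 1)) ^ 2 else 1)) -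
      ∏ i, (if L i ≠ 2 then (if L i = 0 then a i else 0) * ((if L i = 0 then a i else 0) + (if L i = 0 then d i else 1)) else 1)) ^ 2 ≤
    (∏ i, (if L i ≠ 2 then ((if L i = 0 then a i else 0) + (if L i = 0 then d i else 1)) ^ 2 + (if L i = 0 then a i else 0) ^ 2 else 1)) *
    ((∏ i, (if L i ≠ 2 then ((if L i = 0 then a i else 0) + (if L i = 0 then d i else 1)) ^ 2 + (if L i = 0 then d i else 1) ^ 2 else 1)) -
      ∏ i, (if L i ≠ 2 then ((if L i = 0 then a i else 0) + (if L i = 0 then d i else 1)) ^ 2 else 1)) := by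
  rw [pure_prod_eq a d L (fun u w => (u + w) ^ 2), pure_prod_eq a d L (fun u w => u * (u + w)),
    pure_prod_eq a d L (fun u w => (u + w) ^ 2 + u ^ 2), pure_prod_eq a d L (fun u w => (u + w) ^ 2 + w ^ 2)]
  exact boundary_productForm_marked _ _ _

/-- (P) for a pure assignment, vertex joined to `c` (part I, `boundary_productForm_marked'`). [this work] -/
theorem pure_productForm_marked' (a d : ι → ℝ) (L : ι → Fin 3) :
    ((∏ i, (if L i ≠ 2 then ((if L i = 0 then a i else 0) + (if L i = 0 then d i else 1)) ^ 2 else 1)) -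
      ∏ i, (if L i ≠ 2 then (if L i = 0 then d i else 1) * ((if L i = 0 then a i else 0) + (if L i = 0 then d i else 1)) else 1)) ^ 2 ≤
    ((∏ i, (if L i ≠ 2 then ((if L i = 0 then a i else 0) + (if L i = 0 then d i else 1)) ^ 2 + (if L i = 0 then a i else 0) ^ 2 else 1)) -
      ∏ i, (if L i ≠ 2 then ((if L i = 0 then a i else 0) + (if L i = 0 then d i else 1)) ^ 2 else 1)) *
    (∏ i, (if L i ≠ 2 then ((if L i = 0 then a i else 0) + (if L i = 0 then d i else 1)) ^ 2 + (if L i = 0 then d i else 1) ^ 2 else 1)) := by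
  rw [pure_prod_eq a d L (fun u w => (u + w) ^ 2), pure_prod_eq a d L (fun u w => w * (u + w)),
    pure_prod_eq a d L (fun u w => (u + w) ^ 2 + u ^ 2), pure_prod_eq a d L (fun u w => (u + w) ^ 2 + w ^ 2)]
  exact boundary_productForm_marked' _ _ _

omit [DecidableEq ι] in
/-- The pure `A_L = ∏ ((u+w)² + u²) − ∏ (u+w)²` is nonnegative. [this work] -/
theorem pure_A_nonneg (a d : ι → ℝ) (L : ι → Fin 3) :
    0 ≤ (∏ i, (if L i ≠ 2 then ((if L i = 0 then a i else 0) + (if L i = 0 then d i else 1)) ^ 2 + (if L i = 0 then a i else 0) ^ 2 else 1)) -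
      ∏ i, (if L i ≠ 2 then ((if L i = 0 then a i else 0) + (if L i = 0 then d i else 1)) ^ 2 else 1) := by
  rw [sub_nonneg]
  refine Finset.prod_le_prod (fun i _ => ?_) (fun i _ => ?_)
  · by_cases h : L i ≠ 2
    · rw [if_pos h]; positivity
    · rw [if_neg h]; exact zero_le_one
  · by_cases h : L i ≠ 2
    · rw [if_pos h, if_pos h]; exact le_add_of_nonneg_right (sq_nonneg _)
    · rw [if_neg h, if_neg h]

omit [DecidableEq ι] in
/-- The pure `B_L = ∏ ((u+w)² + w²) − ∏ (u+w)²` is nonnegative. [this work] -/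
theorem pure_B_nonneg (a d : ι → ℝ) (L : ι → Fin 3) :
    0 ≤ (∏ i, (if L i ≠ 2 then ((if L i = 0 then a i else 0) + (if L i = 0 then d i else 1)) ^ 2 + (if L i = 0 then d i else 1) ^ 2 else 1)) -
      ∏ i, (if L i ≠ 2 then ((if L i = 0 then a i else 0) + (if L i = 0 then d i else 1)) ^ 2 else 1) := by
  rw [sub_nonneg]
  refine Finset.prod_le_prod (fun i _ => ?_) (fun i _ => ?_)
  · by_cases h : L i ≠ 2
    · rw [if_pos h]; positivity
    · rw [if_neg h]; exact zero_le_one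
  · by_cases h : L i ≠ 2
    · rw [if_pos h, if_pos h]; exact le_add_of_nonneg_right (sq_nonneg _)
    · rw [if_neg h, if_neg h]

/-- The six expansions used below, bundled. [this work] -/
theorem expand_six (a b d n : ι → ℝ) (hP : ∀ i, d i ^ 2 ≤ a i * b i) :
    (∏ i, (a i + b i + d i + n i) =
      ∑ L : ι → Fin 3, (∏ i, (if L i = 0 then (a i)⁻¹ else if L i = 1 then b i - d i ^ 2 / a i else n i - d i)) *
        ∏ i, (if L i ≠ 2 then ((if L i = 0 then a i else 0) + (if L i = 0 then d i else 1)) ^ 2 else 1)) ∧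
    (∏ i, (b i + n i) =
      ∑ L : ι → Fin 3, (∏ i, (if L i = 0 then (a i)⁻¹ else if L i = 1 then b i - d i ^ 2 / a i else n i - d i)) *
        ∏ i, (if L i ≠ 2 then (if L i = 0 then d i else 1) * ((if L i = 0 then a i else 0) + (if L i = 0 then d i else 1)) else 1)) ∧
    (∏ i, (a i + n i) =
      ∑ L : ι → Fin 3, (∏ i, (if L i = 0 then (a i)⁻¹ else if L i = 1 then b i - d i ^ 2 / a i else n i - d i)) *
        ∏ i, (if L i ≠ 2 then (if L i = 0 then a i else 0) * ((if L i = 0 then a i else 0) + (if L i = 0 then d i else 1)) else 1)) ∧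
    (∏ i, n i =
      ∑ L : ι → Fin 3, (∏ i, (if L i = 0 then (a i)⁻¹ else if L i = 1 then b i - d i ^ 2 / a i else n i - d i)) *
        ∏ i, (if L i ≠ 2 then (if L i = 0 then a i else 0) * (if L i = 0 then d i else 1) else 1)) ∧
    (∏ i, (2 * a i + b i + d i + n i) =
      ∑ L : ι → Fin 3, (∏ i, (if L i = 0 then (a i)⁻¹ else if L i = 1 then b i - d i ^ 2 / a i else n i - d i)) *
        ∏ i, (if L i ≠ 2 then ((if L i = 0 then a i else 0) + (if L i = 0 then d i else 1)) ^ 2 + (if L i = 0 then a i else 0) ^ 2 else 1)) ∧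
    (∏ i, (a i + 2 * b i + d i + n i) =
      ∑ L : ι → Fin 3, (∏ i, (if L i = 0 then (a i)⁻¹ else if L i = 1 then b i - d i ^ 2 / a i else n i - d i)) *
        ∏ i, (if L i ≠ 2 then ((if L i = 0 then a i else 0) + (if L i = 0 then d i else 1)) ^ 2 + (if L i = 0 then d i else 1) ^ 2 else 1)) := by
  have h0 : ∀ i, a i = 0 → d i = 0 := fun i h => d_eq_zero_of_a_eq_zero (hP i) h
  refine ⟨?_, ?_, ?_, ?_, ?_, ?_⟩
  · have := expand_form a b d n 1 1 1 1 (fun u w => (u + w) ^ 2) (fun i => by ring) (by norm_num) rfl h0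
    simpa only [one_mul, zero_mul, zero_add, add_zero] using this
  · have := expand_form a b d n 0 1 0 1 (fun u w => w * (u + w)) (fun i => by ring) (by norm_num) rfl h0
    simpa only [one_mul, zero_mul, zero_add, add_zero] using this
  · have := expand_form a b d n 1 0 0 1 (fun u w => u * (u + w)) (fun i => by ring) (by norm_num) rfl h0
    simpa only [one_mul, zero_mul, zero_add, add_zero] using this
  · have := expand_form a b d n 0 0 0 1 (fun u w => u * w) (fun i => by ring) (by norm_num) rfl h0
    simpa only [one_mul, zero_mul, zero_add, add_zero] using this
  · have := expand_form a b d n 2 1 1 1 (fun u w => (u + w) ^ 2 + u ^ 2) (fun i => by ring) (by norm_num) rfl h0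
    simpa only [one_mul, zero_mul, zero_add, add_zero] using this
  · have := expand_form a b d n 1 2 1 1 (fun u w => (u + w) ^ 2 + w ^ 2) (fun i => by ring) (by norm_num) rfl h0
    simpa only [one_mul, zero_mul, zero_add, add_zero] using this

end Expansion

/-! ### 3. The one-step lemma -/

section Main

variable {ι : Type*} [Fintype ι] [DecidableEq ι]

/-- **THE ONE-STEP LEMMA (vertex joined to neither terminal).**  For children with `a ≥ 0, b ≥ 0, d ≤ n, d² ≤ ab` and
`σ = a+b+d+n`:  `(∏ σ − ∏ (b+n) − ∏ (a+n) + ∏ n)² ≤ (∏ (σ+a) − ∏ σ)·(∏ (σ+b) − ∏ σ)`.  In the tree-like fibre class this is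
CONJECTURE (P) `#bad² ≤ #P1·#P2` at a vertex given (P) at its children (gen 58, PROOF-E3 (68j)). [this work] -/
theorem oneStep_productForm (a b d n : ι → ℝ) (ha : ∀ i, 0 ≤ a i) (hb : ∀ i, 0 ≤ b i) (hdn : ∀ i, d i ≤ n i)
    (hP : ∀ i, d i ^ 2 ≤ a i * b i) :
    ((∏ i, (a i + b i + d i + n i)) - (∏ i, (b i + n i)) - (∏ i, (a i + n i)) + ∏ i, n i) ^ 2 ≤
    ((∏ i, (2 * a i + b i + d i + n i)) - ∏ i, (a i + b i + d i + n i)) *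
    ((∏ i, (a i + 2 * b i + d i + n i)) - ∏ i, (a i + b i + d i + n i)) := by
  obtain ⟨e1, e2, e3, e4, e5, e6⟩ := expand_six a b d n hP
  rw [e1, e2, e3, e4, e5, e6]
  simp only [← Finset.sum_sub_distrib, ← Finset.sum_add_distrib, ← mul_sub, ← mul_add]
  -- Cauchy–Schwarz over the pure assignments
  have key := Finset.sum_sq_le_sum_mul_sum_of_sq_le_mul (Finset.univ : Finset (ι → Fin 3))
    (r := fun L => (∏ i, (if L i = 0 then (a i)⁻¹ else if L i = 1 then b i - d i ^ 2 / a i else n i - d i)) *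
      ((∏ i, (if L i ≠ 2 then ((if L i = 0 then a i else 0) + (if L i = 0 then d i else 1)) ^ 2 else 1)) -
      (∏ i, (if L i ≠ 2 then (if L i = 0 then d i else 1) * ((if L i = 0 then a i else 0) + (if L i = 0 then d i else 1)) else 1)) -
      (∏ i, (if L i ≠ 2 then (if L i = 0 then a i else 0) * ((if L i = 0 then a i else 0) + (if L i = 0 then d i else 1)) else 1)) +
      ∏ i, (if L i ≠ 2 then (if L i = 0 then a i else 0) * (if L i = 0 then d i else 1) else 1)))
    (f := fun L => (∏ i, (if L i = 0 then (a i)⁻¹ else if L i = 1 then b i - d i ^ 2 / a i else n i - d i)) *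
      ((∏ i, (if L i ≠ 2 then ((if L i = 0 then a i else 0) + (if L i = 0 then d i else 1)) ^ 2 + (if L i = 0 then a i else 0) ^ 2 else 1)) -
      ∏ i, (if L i ≠ 2 then ((if L i = 0 then a i else 0) + (if L i = 0 then d i else 1)) ^ 2 else 1)))
    (g := fun L => (∏ i, (if L i = 0 then (a i)⁻¹ else if L i = 1 then b i - d i ^ 2 / a i else n i - d i)) *
      ((∏ i, (if L i ≠ 2 then ((if L i = 0 then a i else 0) + (if L i = 0 then d i else 1)) ^ 2 + (if L i = 0 then d i else 1) ^ 2 else 1)) -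
      ∏ i, (if L i ≠ 2 then ((if L i = 0 then a i else 0) + (if L i = 0 then d i else 1)) ^ 2 else 1)))
    (fun L _ => mul_nonneg (weight_nonneg a b d n ha hb hdn hP L) (pure_A_nonneg a d L))
    (fun L _ => mul_nonneg (weight_nonneg a b d n ha hb hdn hP L) (pure_B_nonneg a d L))
    (fun L _ => by
      have hw := weight_nonneg a b d n ha hb hdn hP L
      have hp := pure_productForm a d L
      rw [mul_pow, mul_mul_mul_comm, ← sq]
      exact mul_le_mul_of_nonneg_left hp (sq_nonneg _))
  convert key using 2

/-- **THE ONE-STEP LEMMA, vertex joined to `s`.**  `(∏ σ − ∏ (a+n))² ≤ ∏ (σ+a) · (∏ (σ+b) − ∏ σ)` (the relevant count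
`#P1 = 2∏(σ+a) − ∏σ` is even larger). [this work] -/
theorem oneStep_productForm_marked (a b d n : ι → ℝ) (ha : ∀ i, 0 ≤ a i) (hb : ∀ i, 0 ≤ b i) (hdn : ∀ i, d i ≤ n i)
    (hP : ∀ i, d i ^ 2 ≤ a i * b i) :
    ((∏ i, (a i + b i + d i + n i)) - ∏ i, (a i + n i)) ^ 2 ≤
    (∏ i, (2 * a i + b i + d i + n i)) *
    ((∏ i, (a i + 2 * b i + d i + n i)) - ∏ i, (a i + b i + d i + n i)) := by
  obtain ⟨e1, -, e3, -, e5, e6⟩ := expand_six a b d n hP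
  rw [e1, e3, e5, e6]
  simp only [← Finset.sum_sub_distrib, ← mul_sub]
  have key := Finset.sum_sq_le_sum_mul_sum_of_sq_le_mul (Finset.univ : Finset (ι → Fin 3))
    (r := fun L => (∏ i, (if L i = 0 then (a i)⁻¹ else if L i = 1 then b i - d i ^ 2 / a i else n i - d i)) *
      ((∏ i, (if L i ≠ 2 then ((if L i = 0 then a i else 0) + (if L i = 0 then d i else 1)) ^ 2 else 1)) -
      ∏ i, (if L i ≠ 2 then (if L i = 0 then a i else 0) * ((if L i = 0 then a i else 0) + (if L i = 0 then d i else 1)) else 1)))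
    (f := fun L => (∏ i, (if L i = 0 then (a i)⁻¹ else if L i = 1 then b i - d i ^ 2 / a i else n i - d i)) *
      (∏ i, (if L i ≠ 2 then ((if L i = 0 then a i else 0) + (if L i = 0 then d i else 1)) ^ 2 + (if L i = 0 then a i else 0) ^ 2 else 1)))
    (g := fun L => (∏ i, (if L i = 0 then (a i)⁻¹ else if L i = 1 then b i - d i ^ 2 / a i else n i - d i)) *
      ((∏ i, (if L i ≠ 2 then ((if L i = 0 then a i else 0) + (if L i = 0 then d i else 1)) ^ 2 + (if L i = 0 then d i else 1) ^ 2 else 1)) -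
      ∏ i, (if L i ≠ 2 then ((if L i = 0 then a i else 0) + (if L i = 0 then d i else 1)) ^ 2 else 1)))
    (fun L _ => mul_nonneg (weight_nonneg a b d n ha hb hdn hP L)
      (Finset.prod_nonneg fun i _ => by split_ifs <;> positivity))
    (fun L _ => mul_nonneg (weight_nonneg a b d n ha hb hdn hP L) (pure_B_nonneg a d L))
    (fun L _ => by
      have hp := pure_productForm_marked a d L
      rw [mul_pow, mul_mul_mul_comm, ← sq]
      exact mul_le_mul_of_nonneg_left hp (sq_nonneg _))
  convert key using 2

/-- **THE ONE-STEP LEMMA, vertex joined to `c`.**  `(∏ σ − ∏ (b+n))² ≤ (∏ (σ+a) − ∏ σ) · ∏ (σ+b)`. [this work] -/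
theorem oneStep_productForm_marked' (a b d n : ι → ℝ) (ha : ∀ i, 0 ≤ a i) (hb : ∀ i, 0 ≤ b i) (hdn : ∀ i, d i ≤ n i)
    (hP : ∀ i, d i ^ 2 ≤ a i * b i) :
    ((∏ i, (a i + b i + d i + n i)) - ∏ i, (b i + n i)) ^ 2 ≤
    ((∏ i, (2 * a i + b i + d i + n i)) - ∏ i, (a i + b i + d i + n i)) *
    (∏ i, (a i + 2 * b i + d i + n i)) := by
  obtain ⟨e1, e2, -, -, e5, e6⟩ := expand_six a b d n hP
  rw [e1, e2, e5, e6]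
  simp only [← Finset.sum_sub_distrib, ← mul_sub]
  have key := Finset.sum_sq_le_sum_mul_sum_of_sq_le_mul (Finset.univ : Finset (ι → Fin 3))
    (r := fun L => (∏ i, (if L i = 0 then (a i)⁻¹ else if L i = 1 then b i - d i ^ 2 / a i else n i - d i)) *
      ((∏ i, (if L i ≠ 2 then ((if L i = 0 then a i else 0) + (if L i = 0 then d i else 1)) ^ 2 else 1)) -
      ∏ i, (if L i ≠ 2 then (if L i = 0 then d i else 1) * ((if L i = 0 then a i else 0) + (if L i = 0 then d i else 1)) else 1)))
    (f := fun L => (∏ i, (if L i = 0 then (a i)⁻¹ else if L i = 1 then b i - d i ^ 2 / a i else n i - d i)) *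
      ((∏ i, (if L i ≠ 2 then ((if L i = 0 then a i else 0) + (if L i = 0 then d i else 1)) ^ 2 + (if L i = 0 then a i else 0) ^ 2 else 1)) -
      ∏ i, (if L i ≠ 2 then ((if L i = 0 then a i else 0) + (if L i = 0 then d i else 1)) ^ 2 else 1)))
    (g := fun L => (∏ i, (if L i = 0 then (a i)⁻¹ else if L i = 1 then b i - d i ^ 2 / a i else n i - d i)) *
      (∏ i, (if L i ≠ 2 then ((if L i = 0 then a i else 0) + (if L i = 0 then d i else 1)) ^ 2 + (if L i = 0 then d i else 1) ^ 2 else 1)))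
    (fun L _ => mul_nonneg (weight_nonneg a b d n ha hb hdn hP L) (pure_A_nonneg a d L))
    (fun L _ => mul_nonneg (weight_nonneg a b d n ha hb hdn hP L)
      (Finset.prod_nonneg fun i _ => by split_ifs <;> positivity))
    (fun L _ => by
      have hp := pure_productForm_marked' a d L
      rw [mul_pow, mul_mul_mul_comm, ← sq]
      exact mul_le_mul_of_nonneg_left hp (sq_nonneg _))
  convert key using 2

end Main

end Summit.CriticalPhenomena.PercolationContinuityZ3.Theorems.ProductFormOneStep
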